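import Summits.NavierStokesRegularity.NavierStokesRegularity.Theorems.PlaneEnergyCeilingPlanarEnergyAPrioriSmallDataImprove
import Summits.NavierStokesRegularity.NavierStokesRegularity.Theorems.PlaneEnergyCeilingPlanarEnergyAPrioriSmallDataSlack
import HarnessLib

/-!
# Small planar data: the bootstrap, III — propagation of small planar energies (abstract form)

Route `PlaneEnergyCeiling`, crux `PlanarEnergyAPriori` (stmt-NavierStokesRegularity-16855), small-data
corner. Abstract setting (`ν = 1`): a jointly continuous field `v` on `ℝ × ℝ³`, bounded by `D`, all
of whose slices have planar energies `≤ X_ap²` (crude a priori bounds), solving the Oseen integral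
equation `v(t) = e^{(t−t₀)Δ} v(t₀) − B_{t₀}(v,v)(t)` from every base time `0 ≤ t₀ < t ≤ S₁`.

**Theorem (`planar_small_propagation`).** There are absolute constants `ε* > 0`, `η* > 0` such that:
if the initial slice has planar energies `≤ ε²` on every plane with `0 < ε ≤ ε*`, then every slice
`v(t)`, `0 < t ≤ S₁`, has planar energies `≤ (2ε)²` on every plane, and `√t ‖v(t)‖_∞ ≤ η*`.

Proof: the continuity method of Kato on the pair of scale-invariant quantities
(`X(t) = sup_planes ‖v(t)‖_{L²(plane)}`, `Φ(t) = √t ‖v(t)‖_∞`): the trapped property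
"`X ≤ 2ε ∧ Φ ≤ η` on `(0, τ]`" improves itself (`improve_planar`, `improve_sup`,
`SmallDataImprove.lean`), persists a little beyond any base time (`slack_zero`, `slack_pos`) and is
closed under `τ' ↑ τ` (`closed`, `SmallDataSlack.lean`); the infimum of the times where it fails
can therefore be neither `0`, nor a limit of good times, nor followed by bad times.

## References

* T. Kato, Math. Z. 187 (1984) (small-data continuity method). [Kato1984]
* G. Koch, N. Nadirashvili, G. Seregin, V. Šverák, Acta Math. 203 (2009), §4 (arXiv:0709.3599).
  [KochNadirashviliSereginSverak2009]
-/

noncomputable section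

-- single-conjunct summit: `Summit.<Summit>.<Problem>` repeats the name by the D-0017 layout
set_option linter.dupNamespace false

namespace Summit.NavierStokesRegularity.NavierStokesRegularity.Theorems.PlanarEnergyAPriori.SmallData

open MeasureTheory Set Function Filter Topology TopologicalSpace Metric WithLp
open scoped NNReal ENNReal
open Literature.Analysis Literature.Analysis.FluidPDE Literature.Analysis.FunctionSpaces

/-- **Propagation of small planar energies along the Oseen equation (abstract, `ν = 1`).** There
are absolute `ε* > 0` and `η* > 0` such that for every jointly continuous, jointly measurable field
`v` on `ℝ × ℝ³` with `‖v‖ ≤ D`, planar energies `≤ X_ap²` on every slice, solving the Oseen integral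
equation from every base time `0 ≤ t₀ < t ≤ S₁` (`S₁ > 0`): if `v(0)` has planar energies `≤ ε²` with
`0 < ε ≤ ε*`, then for every `0 < t ≤ S₁` the slice `v(t)` has planar energies `≤ (2ε)²` on every
plane and `√t ‖v(t, x)‖ ≤ η*` for every `x`. [cite: Kato1984, §1 (the continuity method); KNSS 2009 §4 for the Oseen form] -/
theorem planar_small_propagation :
    ∃ εstar ηstar : ℝ, 0 < εstar ∧ 0 < ηstar ∧
      ∀ {v : ℝ → EuclideanSpace ℝ (Fin 3) → EuclideanSpace ℝ (Fin 3)},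
        Measurable (uncurry v) → (∀ s, Continuous (v s)) → Continuous (uncurry v) →
        ∀ {D Xap : ℝ}, (∀ s x, ‖v s x‖ ≤ D) → 0 ≤ Xap →
        (∀ s (R : EuclideanSpace ℝ (Fin 3) ≃ₗᵢ[ℝ] EuclideanSpace ℝ (Fin 3)) (c : ℝ),
          ∫⁻ y : EuclideanSpace ℝ (Fin 2), ‖v s (R (toLp 2 ![y 0, y 1, c]))‖ₑ ^ 2 ≤ ENNReal.ofReal (Xap ^ 2)) →
        ∀ {S₁ : ℝ}, 0 < S₁ →
        (∀ t₀ t, 0 ≤ t₀ → t₀ < t → t ≤ S₁ → ∀ x,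
          v t x = UnboundedOperators.heatExtension (v t₀) (t - t₀) x - oseenDuhamel 1 t₀ v v t x) →
        ∀ {ε : ℝ}, 0 < ε → ε ≤ εstar →
        (∀ (R : EuclideanSpace ℝ (Fin 3) ≃ₗᵢ[ℝ] EuclideanSpace ℝ (Fin 3)) (c : ℝ),
          ∫⁻ y : EuclideanSpace ℝ (Fin 2), ‖v 0 (R (toLp 2 ![y 0, y 1, c]))‖ₑ ^ 2 ≤ ENNReal.ofReal (ε ^ 2)) →
        ∀ t ∈ Ioc 0 S₁,
          (∀ (R : EuclideanSpace ℝ (Fin 3) ≃ₗᵢ[ℝ] EuclideanSpace ℝ (Fin 3)) (c : ℝ),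
            ∫⁻ y : EuclideanSpace ℝ (Fin 2), ‖v t (R (toLp 2 ![y 0, y 1, c]))‖ₑ ^ 2 ≤ ENNReal.ofReal ((2 * ε) ^ 2)) ∧
          ∀ x, Real.sqrt t * ‖v t x‖ ≤ ηstar := by
  -- ### the absolute constants
  obtain ⟨C₁, hC₁, hC₁spec⟩ := planarEnergy_le_of_oseenRepr
  obtain ⟨K, hK, hKspec⟩ := exists_norm_oseenSlice_le_of_morrey
  set C₀ : ℝ := oseenSliceConst (EuclideanSpace ℝ (Fin 3)) with hC₀
  have hC₀pos : 0 < C₀ := oseenSliceConst_pos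
  set Ah : ℝ := 2048 * (4 * Real.pi) ^ (-(3 : ℝ) / 2) *
    Real.sqrt (2 * (volume (ball (0 : EuclideanSpace ℝ (Fin 3)) 1)).toReal) with hAh
  have hAh0 : 0 ≤ Ah := by positivity
  set η : ℝ := min (1 / (16 * Real.sqrt 2 * C₁)) (1 / (16 * C₀)) with hη
  have hs2 : 0 < Real.sqrt 2 := Real.sqrt_pos.2 two_pos
  have hηpos : 0 < η := lt_min (by positivity) (by positivity)
  set εstar : ℝ := min 1 (η / (4 * (Ah + 16 * Real.sqrt 2 * K))) with hεstar
  have hεstar_pos : 0 < εstar := lt_min one_pos (by positivity)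
  refine ⟨εstar, η, hεstar_pos, hηpos, ?_⟩
  intro v hvm hvs hvc D Xap hD hXap0 hXap S₁ hS₁ hrep ε hε hεle hX0
  -- ### consequences of the smallness
  have hε1 : ε ≤ 1 := hεle.trans (min_le_left _ _)
  have hε2 : ε ≤ η / (4 * (Ah + 16 * Real.sqrt 2 * K)) := hεle.trans (min_le_right _ _)
  have hη1 : η ≤ 1 / (16 * Real.sqrt 2 * C₁) := min_le_left _ _
  have hη2 : η ≤ 1 / (16 * C₀) := min_le_right _ _
  have hfac : 1 + 8 * Real.sqrt 2 * C₁ * η ≤ 3 / 2 := by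
    have h : 8 * Real.sqrt 2 * C₁ * η ≤ 8 * Real.sqrt 2 * C₁ * (1 / (16 * Real.sqrt 2 * C₁)) :=
      mul_le_mul_of_nonneg_left hη1 (by positivity)
    have h' : 8 * Real.sqrt 2 * C₁ * (1 / (16 * Real.sqrt 2 * C₁)) = 1 / 2 := by field_simp; ring
    linarith
  have hsup_half : Ah * ε + 16 * Real.sqrt 2 * K * ε ^ 2 + 4 * C₀ * η ^ 2 ≤ η / 2 := by
    have h1 : Ah * ε + 16 * Real.sqrt 2 * K * ε ^ 2 ≤ (Ah + 16 * Real.sqrt 2 * K) * ε := by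
      have : ε ^ 2 ≤ ε := by nlinarith
      nlinarith [mul_le_mul_of_nonneg_left this (by positivity : (0 : ℝ) ≤ 16 * Real.sqrt 2 * K)]
    have h2 : (Ah + 16 * Real.sqrt 2 * K) * ε ≤ η / 4 := by
      have hpos : 0 < 4 * (Ah + 16 * Real.sqrt 2 * K) := by positivity
      have := mul_le_mul_of_nonneg_left hε2 hpos.le
      rw [mul_div_cancel₀ _ hpos.ne'] at this
      linarith
    have h3 : 4 * C₀ * η ^ 2 ≤ η / 4 := by
      have : 4 * C₀ * η ≤ 4 * C₀ * (1 / (16 * C₀)) := mul_le_mul_of_nonneg_left hη2 (by positivity)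
      have h' : 4 * C₀ * (1 / (16 * C₀)) = 1 / 4 := by field_simp; ring
      nlinarith
    linarith
  -- ### the trapped property
  set P : ℝ → Prop := fun τ =>
    (∀ s ∈ Ioc 0 τ, ∀ (R : EuclideanSpace ℝ (Fin 3) ≃ₗᵢ[ℝ] EuclideanSpace ℝ (Fin 3)) (c : ℝ),
      ∫⁻ y : EuclideanSpace ℝ (Fin 2), ‖v s (R (toLp 2 ![y 0, y 1, c]))‖ₑ ^ 2 ≤ ENNReal.ofReal ((2 * ε) ^ 2)) ∧
    ∀ s ∈ Ioc 0 τ, ∀ x, Real.sqrt s * ‖v s x‖ ≤ η with hP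
  have hPmono : ∀ {τ τ' : ℝ}, P τ → τ' ≤ τ → P τ' := fun {τ τ'} h hle =>
    ⟨fun s hs => h.1 s ⟨hs.1, hs.2.trans hle⟩, fun s hs => h.2 s ⟨hs.1, hs.2.trans hle⟩⟩
  -- improvement on `(0, τ]`, `τ ≤ S₁`
  have hImp : ∀ {τ : ℝ}, τ ≤ S₁ → P τ → ∀ t ∈ Ioc 0 τ,
      (∀ (R : EuclideanSpace ℝ (Fin 3) ≃ₗᵢ[ℝ] EuclideanSpace ℝ (Fin 3)) (c : ℝ),
        ∫⁻ y : EuclideanSpace ℝ (Fin 2), ‖v t (R (toLp 2 ![y 0, y 1, c]))‖ₑ ^ 2 ≤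
          ENNReal.ofReal ((3 / 2 * ε) ^ 2)) ∧
      ∀ x, Real.sqrt t * ‖v t x‖ ≤ η / 2 := by
    intro τ hτS hPτ t ht
    have hrep0 : ∀ t' ∈ Ioc 0 τ, ∀ x,
        v t' x = UnboundedOperators.heatExtension (v 0) (t' - 0) x - oseenDuhamel 1 0 v v t' x :=
      fun t' ht' x => hrep 0 t' le_rfl ht'.1 (ht'.2.trans hτS) x
    refine ⟨fun R c => ?_, fun x => ?_⟩
    · have h := improve_planar hC₁ hC₁spec hvm hvs hε.le hηpos.le hX0 hrep0 hPτ.1 hPτ.2 ht R c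
      refine h.trans (ENNReal.ofReal_le_ofReal ?_)
      have hnn : 0 ≤ (1 + 8 * Real.sqrt 2 * C₁ * η) * ε := by positivity
      exact pow_le_pow_left₀ hnn (by nlinarith) 2
    · have h := improve_sup hK hKspec hvs hε.le hX0 hrep0 hPτ.1 hPτ.2 ht x
      exact h.trans hsup_half
  -- slack from `0`
  have hSlack0 : ∃ δ : ℝ, 0 < δ ∧ P (min δ S₁) := by
    have hrep0 : ∀ t, 0 < t → t ≤ S₁ → ∀ x,
        v t x = UnboundedOperators.heatExtension (v 0) (t - 0) x - oseenDuhamel 1 0 v v t x :=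
      fun t ht htS x => hrep 0 t le_rfl ht htS x
    obtain ⟨δ, hδ, h⟩ := slack_zero hC₁ hC₁spec hvm hvs hD hXap0 hXap hrep0 hε hηpos hX0
    refine ⟨δ, hδ, fun s hs => (h s hs.1 (hs.2.trans (min_le_left _ _)) (hs.2.trans (min_le_right _ _))).1,
      fun s hs => (h s hs.1 (hs.2.trans (min_le_left _ _)) (hs.2.trans (min_le_right _ _))).2⟩
  -- slack from a good positive time
  have hSlackτ : ∀ {τ : ℝ}, 0 < τ → τ < S₁ → P τ → ∃ δ : ℝ, 0 < δ ∧ P (min (τ + δ) S₁) := by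
    intro τ hτ hτS hPτ
    obtain ⟨hXτ, hΦτ⟩ := hImp hτS.le hPτ τ ⟨hτ, le_rfl⟩
    have hsτ : 0 < Real.sqrt τ := Real.sqrt_pos.2 hτ
    have hΦτ' : ∀ x, ‖v τ x‖ ≤ η / (2 * Real.sqrt τ) := fun x => by
      rw [le_div_iff₀ (by positivity)]
      have := hΦτ x
      nlinarith
    have hrepτ : ∀ t, τ < t → t ≤ S₁ → ∀ x,
        v t x = UnboundedOperators.heatExtension (v τ) (t - τ) x - oseenDuhamel 1 τ v v t x :=
      fun t ht htS x => hrep τ t hτ.le ht htS x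
    obtain ⟨δ, hδ, h⟩ := slack_pos hC₁ hC₁spec hvm hvs hD hXap0 hXap hτ hτS.le hrepτ hε hηpos hXτ hΦτ'
    refine ⟨δ, hδ, fun s hs R c => ?_, fun s hs x => ?_⟩
    · rcases le_or_gt s τ with hle | hgt
      · exact hPτ.1 s ⟨hs.1, hle⟩ R c
      · exact (h s hgt (hs.2.trans (min_le_left _ _)) (hs.2.trans (min_le_right _ _))).1 R c
    · rcases le_or_gt s τ with hle | hgt
      · exact hPτ.2 s ⟨hs.1, hle⟩ x
      · exact (h s hgt (hs.2.trans (min_le_left _ _)) (hs.2.trans (min_le_right _ _))).2 x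
  -- closedness
  have hClosed : ∀ {τ : ℝ}, 0 < τ → (∀ τ' ∈ Ioo 0 τ, P τ') → P τ :=
    fun {τ} hτ h => closed hvc hτ h
  -- ### the exit-time argument: `P S₁`
  have hPS₁ : P S₁ := by
    by_contra hcon
    set B : Set ℝ := {τ | 0 ≤ τ ∧ τ ≤ S₁ ∧ ¬ P τ} with hB
    have hS₁B : S₁ ∈ B := ⟨hS₁.le, le_rfl, hcon⟩
    have hBne : B.Nonempty := ⟨S₁, hS₁B⟩
    have hBbdd : BddBelow B := ⟨0, fun τ hτ => hτ.1⟩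
    set τs : ℝ := sInf B with hτs
    have hτs0 : 0 ≤ τs := le_csInf hBne fun τ hτ => hτ.1
    have hτsS : τs ≤ S₁ := csInf_le hBbdd hS₁B
    -- good times below the infimum
    have hbelow : ∀ τ', 0 < τ' → τ' < τs → P τ' := by
      intro τ' h1 h2
      by_contra hn
      exact notMem_of_lt_csInf h2 hBbdd ⟨h1.le, h2.le.trans hτsS, hn⟩
    -- a good time `m` with no bad time below it forces `m ≤ τs`
    have hforce : ∀ {m : ℝ}, P m → m ≤ τs := by
      intro m hPm
      refine le_csInf hBne fun τ hτ => ?_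
      by_contra hlt
      exact hτ.2.2 (hPmono hPm (le_of_not_ge hlt))
    rcases hτs0.eq_or_lt with hzero | hpos
    · -- `τs = 0`: slack from `0`
      obtain ⟨δ, hδ, hPδ⟩ := hSlack0
      have hm : 0 < min δ S₁ := lt_min hδ hS₁
      have := hforce hPδ
      rw [← hzero] at this
      exact absurd this (not_le.2 hm)
    · -- `τs > 0`: closedness, then slack
      have hPτs : P τs := hClosed hpos fun τ' hτ' => hbelow τ' hτ'.1 hτ'.2
      rcases hτsS.eq_or_lt with hEq | hlt
      · exact hcon (hEq ▸ hPτs)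
      · obtain ⟨δ, hδ, hPδ⟩ := hSlackτ hpos hlt hPτs
        have hm : τs < min (τs + δ) S₁ := lt_min (by linarith) hlt
        exact absurd (hforce hPδ) (not_le.2 hm)
  -- ### conclusion
  intro t ht
  exact ⟨hPS₁.1 t ht, hPS₁.2 t ht⟩

/-! ### Registered form -/

/-- **Propagation of small planar energies, closed form** (registered sub-goal of
stmt-NavierStokesRegularity-16855): the statement of `planar_small_propagation` with explicit
binders. [cite: Kato1984, §1 (the continuity method); KNSS 2009 §4 for the Oseen form] -/
theorem planar_small_propagation_closedForm :
    ∃ εstar ηstar : ℝ, 0 < εstar ∧ 0 < ηstar ∧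
      ∀ (v : ℝ → EuclideanSpace ℝ (Fin 3) → EuclideanSpace ℝ (Fin 3)),
        Measurable (Function.uncurry v) → (∀ s, Continuous (v s)) → Continuous (Function.uncurry v) →
        ∀ (D Xap : ℝ), (∀ s x, ‖v s x‖ ≤ D) → 0 ≤ Xap →
        (∀ s (R : EuclideanSpace ℝ (Fin 3) ≃ₗᵢ[ℝ] EuclideanSpace ℝ (Fin 3)) (c : ℝ),
          ∫⁻ y : EuclideanSpace ℝ (Fin 2), ‖v s (R (WithLp.toLp 2 ![y 0, y 1, c]))‖ₑ ^ 2 ≤ ENNReal.ofReal (Xap ^ 2)) →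
        ∀ (S₁ : ℝ), 0 < S₁ →
        (∀ t₀ t, 0 ≤ t₀ → t₀ < t → t ≤ S₁ → ∀ x,
          v t x = Literature.Analysis.UnboundedOperators.heatExtension (v t₀) (t - t₀) x -
            Literature.Analysis.FluidPDE.oseenDuhamel 1 t₀ v v t x) →
        ∀ (ε : ℝ), 0 < ε → ε ≤ εstar →
        (∀ (R : EuclideanSpace ℝ (Fin 3) ≃ₗᵢ[ℝ] EuclideanSpace ℝ (Fin 3)) (c : ℝ),
          ∫⁻ y : EuclideanSpace ℝ (Fin 2), ‖v 0 (R (WithLp.toLp 2 ![y 0, y 1, c]))‖ₑ ^ 2 ≤ ENNReal.ofReal (ε ^ 2)) →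
        ∀ t ∈ Set.Ioc 0 S₁,
          (∀ (R : EuclideanSpace ℝ (Fin 3) ≃ₗᵢ[ℝ] EuclideanSpace ℝ (Fin 3)) (c : ℝ),
            ∫⁻ y : EuclideanSpace ℝ (Fin 2), ‖v t (R (WithLp.toLp 2 ![y 0, y 1, c]))‖ₑ ^ 2 ≤
              ENNReal.ofReal ((2 * ε) ^ 2)) ∧
          ∀ x, Real.sqrt t * ‖v t x‖ ≤ ηstar := by
  obtain ⟨εstar, ηstar, hε, hη, h⟩ := planar_small_propagation
  exact ⟨εstar, ηstar, hε, hη, fun v hvm hvs hvc D Xap hD hXap0 hXap S₁ hS₁ hrep ε hε' hεle hX0 t ht =>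
    h hvm hvs hvc hD hXap0 hXap hS₁ hrep hε' hεle hX0 t ht⟩

end Summit.NavierStokesRegularity.NavierStokesRegularity.Theorems.PlanarEnergyAPriori.SmallData

end
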